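import Summits.HodgeConjecture.HodgeConjecture.Theorems.R90S6TorusFixedSpecialCount            -- ★ W8-i′ FILE 1 (letters `U ⧸ K₀`, section `r`, `inv_mul_mul_mem_of_smul_eq`)
import Literature.NumberTheory.Automorphic.ResiduallyTrivialFixedCosetCountCayley               -- ★ ROW 0 = #Fix(Y) `ncard_fixedBy_unitary_rank_zero_eq_natCard_fixedBy_of_mem_adjoin`
import Literature.NumberTheory.Automorphic.UnitaryLatticeTreeFixedCosetStrataDictionary         -- ★ `coe_out_inv_mul_mul_out_mem_glInt_of_mem_fixedBy'`, `v_lt_one_iff_le_v_of_v_eq`; brings the ★ `Valued`↔`ValuativeRel` bridge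
import Literature.NumberTheory.Automorphic.UnitaryFixedCosetsStableLattices                     -- ★ `unitaryInt_eq_glInt_subgroupOf`
import Literature.NumberTheory.Automorphic.UnitaryGroupRankOneBigCell                           -- ★ `mem_glInt_iff_forall_v_le_one` for `g ∈ U(σ, J)`
import HarnessLib

/-!
# R90 · S6 — LINE G1 «geometric fixed subtree», RUNG 2 (A): THE LEVEL-ONE COUNT IS THE FIXED-POINT COUNT OF A CAYLEY UNIT — `ℓ₁(γ) = #Fix_Y(U ⧸ K₀)`
# (`Theorems/R90S6LevelOneCountCayleyDictionary.lean`)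

Cell `hodgecm-mathlib`, crux H413 (`stmt-HodgeConjecture-24833`), route of record `HCCMUnconditional`; programme R90-TF, section S6 (base `R90-C14`), seat R90-C14-p07 (g0);
S6 dealer R90-C14-plan (g2) RULING G1-R2 (R90 bus 2026-09-05T01:08:15Z) «(R2) IS WANTED IN S6's ABSTRACT (FILE-1) LETTERS», part (A) = (R2.a)+(R2.b) of the cut
(heads `R90/R90-C14-p07/g0/S6_G1_rung2_HEADS.R90-C14-p07-g0.lean` 153a7dd73d879dd3, dealer «=» 01:14:28Z, audit1 HEADS BOX CLEAN 01:19:53Z, sheet v1.3 §5).  Helper lane `--supports stmt-HodgeConjecture-24833 --as helper`; THEOREMS ONLY (no definition, no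
instance, no notation, no named fact, no `sorry`); imports = ★ W8-i′ FILE 1 + ★ `ResiduallyTrivialFixedCosetCountCayley` + ★ `UnitaryLatticeTreeFixedCosetStrataDictionary`
+ ★ `UnitaryFixedCosetsStableLattices` + ★ `UnitaryGroupRankOneBigCell` + HarnessLib.

THE MATHEMATICS [Kottwitz1986BaseChangeUnits, §1 pp. 240–241; Rogawski1990, §4.9 Prop. 4.9.1 (b) p. 55; Serre1980Trees, II §1.1–1.2].  `K` valued (`Valued K ℤᵐ⁰` + the compatible `ValuativeRel`),
`U = U(σ, J₀)(K)`, `K₀ = U ∩ GL₃(𝒪) = (glInt 3 K).subgroupOf U`, `γ ∈ U`, `u ∈ K` a norm-one unit scalar (`σu·u = 1`) and `γ₁ = u⁻¹γ ∈ U`.  Rung 1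
(★ `natCard_fixedBy_special_eq_one_add_mul_of_residually_unipotent`) reduced `a₁(γ)` to the LEVEL-ONE COUNT `ℓ₁(γ) = #{x ∈ Fix_γ(U ⧸ K₀) : r(x)⁻¹γr(x) ≡ c·1 (mod 𝔪)}`
(`r` a section, `c ≡ u (mod 𝔪)` a unit).  Here: (§1) the central unit scalar `u·1 ∈ K₀` acts trivially on `U ⧸ K₀`, so `Fix_{γ₁} = Fix_γ`, and the level-one predicate is
invariant under the change of representative `r(x) ↦ x.out` (conjugation by `K₀`) and under `c ↦ u`; (§2) for `q ∈ Fix_γ` the predicate is ★ ROW-0's stratum condition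
`rank(red(q.out⁻¹γ₁q.out) − 1) = 0` (★ `rank_redMat_sub_one_eq_zero_iff_forall_valuation_le` through the ★ `Valued`↔`ValuativeRel` bridge), hence
`ℓ₁(γ) = #{q ∈ Fix_{γ₁}(U ⧸ K₀) : rank(red(q.out⁻¹γ₁q.out) − 1) = 0}` (`natCard_levelOne_eq_ncard_rankZero`); (§3) ★ ROW 0 = #Fix(Y)
(`ncard_fixedBy_unitary_rank_zero_eq_natCard_fixedBy_of_mem_adjoin`): for a unit `Y ∈ U` of the shifted order (`Y, Y⁻¹ ∈ 𝒪[X]`, `X ∈ 𝒪[Y]`, `X = 1 + ϖ⁻¹(γ₁ − 1)`),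
**`ℓ₁(γ) = #Fix_Y(U ⧸ K₀)`** (`natCard_levelOne_eq_natCard_fixedBy_of_mem_adjoin`, head (R2.b)); (§4) `Fix_Y ⊆ Fix_γ` (a `Y`-stable unimodular lattice is `𝒪[Y] ∋ X`-stable,
hence `γ₁ = 1 + ϖX`-stable), so `Fix_Y` is finite when `Fix_γ` is (`finite_fixedBy_of_mem_adjoin`) — the finiteness binder ★ a₀ needs at `Y`.
HONEST LABEL: a dictionary over ★ ROW-0, count-neutral; the Cayley unit `Y` of a type-(2) `γ` and its exponents are part (B) (`R90S6TypeTwoCayleyShift`), the closed form part (C).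
HC_CM is proved only modulo the 7 printed citations (2 remaining named inputs: hLiu418 = stmt-HodgeConjecture-24832, h413 = stmt-HodgeConjecture-24833) until rung 0 closes.

## References
* [Kottwitz1986BaseChangeUnits] R. E. Kottwitz, *Base change for unit elements of Hecke algebras*, Compositio Math. 60 (1986) 237–250, §1 pp. 240–241 (fixed-point
  formulas on the building; Theorem p. 243).
* [Rogawski1990] J. D. Rogawski, *Automorphic Representations of Unitary Groups in Three Variables*, Ann. of Math. Stud. 123 (1990), §4.9 Prop. 4.9.1 (b) p. 55.
* [Serre1980Trees] J.-P. Serre, *Trees* (1980), Ch. II §1.1–1.2.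
-/
set_option autoImplicit false
-- the mandated namespace repeats the single-problem summit's segment (`HodgeConjecture.HodgeConjecture`)
set_option linter.dupNamespace false

noncomputable section

open MulAction
open Literature.NumberTheory.Automorphic Literature.NumberTheory.Automorphic.HermitianLattice Literature.NumberTheory.Automorphic.UnitaryGroup
open Literature.NumberTheory.Automorphic.UnitaryLatticeTree Literature.NumberTheory.Automorphic.IntegralReduction
open scoped Matrix MatrixGroups WithZero ValuativeRel

namespace Summit.HodgeConjecture.HodgeConjecture.R90.S6

variable {K : Type*} [Field K] [Valued K ℤᵐ⁰] {σ : K →+* K}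

/-! ### §1 Central unit scalars and the invariances of the level-one predicate -/

omit [Valued K ℤᵐ⁰] in
/-- **The norm-one unit scalar `u·1 ∈ U(σ, J₀)`** (as a group element, inverse `u⁻¹·1`). [cite: Rogawski1990, §4.9 p. 54] -/
theorem exists_unitScalar_mem_unitaryGroupOfForm {u : K} (hσu : σ u * u = 1) :
    ∃ z : ↥(unitaryGroupOfForm σ ((StdForm.antidiagonal 3).over K)),
      ((z : GL (Fin 3) K) : Matrix (Fin 3) (Fin 3) K) = u • (1 : Matrix (Fin 3) (Fin 3) K) ∧
        ((((z : GL (Fin 3) K))⁻¹ : GL (Fin 3) K) : Matrix (Fin 3) (Fin 3) K) = u⁻¹ • (1 : Matrix (Fin 3) (Fin 3) K) := by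
  have hu0 : u ≠ 0 := fun h => by rw [h, mul_zero] at hσu; exact zero_ne_one hσu
  let zG : GL (Fin 3) K := ⟨u • 1, u⁻¹ • 1, by rw [smul_mul_smul_comm, mul_inv_cancel₀ hu0, Matrix.mul_one, one_smul],
    by rw [smul_mul_smul_comm, inv_mul_cancel₀ hu0, Matrix.mul_one, one_smul]⟩
  have hz : zG ∈ unitaryGroupOfForm σ ((StdForm.antidiagonal 3).over K) := by
    rw [mem_unitaryGroupOfForm_antidiagonal_iff]
    intro x y
    change B₀ σ 3 ((u • (1 : Matrix (Fin 3) (Fin 3) K)) *ᵥ x) ((u • (1 : Matrix (Fin 3) (Fin 3) K)) *ᵥ y) = _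
    rw [Matrix.smul_mulVec, Matrix.smul_mulVec, Matrix.one_mulVec, Matrix.one_mulVec, LinearMap.map_smulₛₗ₂, map_smul, smul_eq_mul, smul_eq_mul,
      ← mul_assoc, hσu, one_mul]
  exact ⟨⟨zG, hz⟩, rfl, rfl⟩

set_option synthInstance.maxHeartbeats 400000 in
-- the subgroup-quotient carrier `U ⧸ K₀` of ★ FILE 1 is slow to elaborate (same budget as ★ FILE 1)
/-- A central unit scalar lies in `K₀` and acts trivially on `U ⧸ K₀`. [cite: Rogawski1990, §4.9 p. 54] -/
theorem unitScalar_smul_eq [ValuativeRel K] [(Valued.v : Valuation K ℤᵐ⁰).Compatible] (hvσ : ∀ a, Valued.v (σ a) = Valued.v a) {u : K} (hvu : Valued.v u = 1)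
    {z : ↥(unitaryGroupOfForm σ ((StdForm.antidiagonal 3).over K))} (hz : ((z : GL (Fin 3) K) : Matrix (Fin 3) (Fin 3) K) = u • (1 : Matrix (Fin 3) (Fin 3) K))
    (q : ↥(unitaryGroupOfForm σ ((StdForm.antidiagonal 3).over K)) ⧸ (glInt 3 K).subgroupOf (unitaryGroupOfForm σ ((StdForm.antidiagonal 3).over K))) :
    z • q = q := by
  have hzK : z ∈ (glInt 3 K).subgroupOf (unitaryGroupOfForm σ ((StdForm.antidiagonal 3).over K)) := by
    rw [Subgroup.mem_subgroupOf, UnitaryGroup.mem_glInt_iff_forall_v_le_one σ rfl hvσ]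
    intro i j
    rw [hz, Matrix.smul_apply, Matrix.one_apply, smul_eq_mul]
    split_ifs
    · rw [mul_one, hvu]
    · rw [mul_zero, map_zero]; exact zero_le_one
  have hcomm : ∀ g : ↥(unitaryGroupOfForm σ ((StdForm.antidiagonal 3).over K)), g * z = z * g := by
    intro g
    apply Subtype.ext; apply Units.ext
    rw [Subgroup.coe_mul, Subgroup.coe_mul, Units.val_mul, Units.val_mul, hz, Matrix.mul_smul, Matrix.smul_mul, Matrix.mul_one, Matrix.one_mul]
  induction q using QuotientGroup.induction_on with
  | H g =>
    change (↑(z * g) : ↥(unitaryGroupOfForm σ ((StdForm.antidiagonal 3).over K)) ⧸ (glInt 3 K).subgroupOf (unitaryGroupOfForm σ ((StdForm.antidiagonal 3).over K))) = ↑g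
    rw [QuotientGroup.eq, ← hcomm, mul_inv_rev, inv_mul_cancel_right]
    exact Subgroup.inv_mem _ hzK

set_option synthInstance.maxHeartbeats 400000 in
-- as above
/-- `Fix_{zγ}(U ⧸ K₀) = Fix_γ(U ⧸ K₀)` for a central unit scalar `z`. [cite: Rogawski1990, §4.9 p. 54] -/
theorem fixedBy_unitScalar_mul_eq [ValuativeRel K] [(Valued.v : Valuation K ℤᵐ⁰).Compatible] (hvσ : ∀ a, Valued.v (σ a) = Valued.v a) {u : K} (hvu : Valued.v u = 1)
    {z : ↥(unitaryGroupOfForm σ ((StdForm.antidiagonal 3).over K))} (hz : ((z : GL (Fin 3) K) : Matrix (Fin 3) (Fin 3) K) = u • (1 : Matrix (Fin 3) (Fin 3) K))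
    (γ : ↥(unitaryGroupOfForm σ ((StdForm.antidiagonal 3).over K))) :
    fixedBy (↥(unitaryGroupOfForm σ ((StdForm.antidiagonal 3).over K)) ⧸ (glInt 3 K).subgroupOf (unitaryGroupOfForm σ ((StdForm.antidiagonal 3).over K))) (z * γ) =
      fixedBy (↥(unitaryGroupOfForm σ ((StdForm.antidiagonal 3).over K)) ⧸ (glInt 3 K).subgroupOf (unitaryGroupOfForm σ ((StdForm.antidiagonal 3).over K))) γ := by
  ext q
  rw [MulAction.mem_fixedBy, MulAction.mem_fixedBy, mul_smul, unitScalar_smul_eq hvσ hvu hz]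

/-- **The level-one predicate is invariant under `K₀`-conjugation** (change of representative of a coset): for `κ ∈ GL₃(𝒪)`,
`κ⁻¹Mκ ≡ c·1 (mod 𝔪) ⟺ M ≡ c·1 (mod 𝔪)`. [cite: Kottwitz1986BaseChangeUnits, §1 pp. 240–241] -/
theorem forall_v_conj_sub_lt_one_iff {M : Matrix (Fin 3) (Fin 3) K} {κ : GL (Fin 3) K}
    (hκ : ∀ i j, Valued.v ((κ : Matrix (Fin 3) (Fin 3) K) i j) ≤ 1) (hκ' : ∀ i j, Valued.v (((κ⁻¹ : GL (Fin 3) K) : Matrix (Fin 3) (Fin 3) K) i j) ≤ 1) (c : K) :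
    (∀ i j, Valued.v ((((κ⁻¹ : GL (Fin 3) K) : Matrix (Fin 3) (Fin 3) K) * M * (κ : Matrix (Fin 3) (Fin 3) K)) i j - c * (1 : Matrix (Fin 3) (Fin 3) K) i j) < 1) ↔
      ∀ i j, Valued.v (M i j - c * (1 : Matrix (Fin 3) (Fin 3) K) i j) < 1 := by
  -- `X ↦ P X Q` preserves «all entries in `𝔪`» for integral `P, Q`, and `κ⁻¹(M − c·1)κ = κ⁻¹Mκ − c·1`
  have key : ∀ (P Q X : Matrix (Fin 3) (Fin 3) K), (∀ i j, Valued.v (P i j) ≤ 1) → (∀ i j, Valued.v (Q i j) ≤ 1) →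
      (∀ i j, Valued.v (X i j) < 1) → ∀ i j, Valued.v ((P * X * Q) i j) < 1 := by
    intro P Q X hP hQ hX i j
    rw [Matrix.mul_apply]
    refine Valuation.map_sum_lt _ one_ne_zero fun l _ => ?_
    rw [Matrix.mul_apply, Finset.sum_mul, ]
    refine Valuation.map_sum_lt _ one_ne_zero fun m _ => ?_
    rw [map_mul, map_mul]
    calc Valued.v (P i m) * Valued.v (X m l) * Valued.v (Q l j) ≤ 1 * Valued.v (X m l) * 1 :=
          mul_le_mul' (mul_le_mul' (hP i m) le_rfl) (hQ l j)
      _ < 1 := by rw [one_mul, mul_one]; exact hX m l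
  have hsub : ∀ (X : Matrix (Fin 3) (Fin 3) K) (i j : Fin 3), X i j - c * (1 : Matrix (Fin 3) (Fin 3) K) i j = (X - c • (1 : Matrix (Fin 3) (Fin 3) K)) i j :=
    fun X i j => by rw [Matrix.sub_apply, Matrix.smul_apply, smul_eq_mul]
  have hκκ : ((κ⁻¹ : GL (Fin 3) K) : Matrix (Fin 3) (Fin 3) K) * (κ : Matrix (Fin 3) (Fin 3) K) = 1 := by
    rw [← Units.val_mul, inv_mul_cancel, Units.val_one]
  have hκκ' : (κ : Matrix (Fin 3) (Fin 3) K) * ((κ⁻¹ : GL (Fin 3) K) : Matrix (Fin 3) (Fin 3) K) = 1 := by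
    rw [← Units.val_mul, mul_inv_cancel, Units.val_one]
  have hconj : ((κ⁻¹ : GL (Fin 3) K) : Matrix (Fin 3) (Fin 3) K) * M * (κ : Matrix (Fin 3) (Fin 3) K) - c • (1 : Matrix (Fin 3) (Fin 3) K) =
      ((κ⁻¹ : GL (Fin 3) K) : Matrix (Fin 3) (Fin 3) K) * (M - c • (1 : Matrix (Fin 3) (Fin 3) K)) * (κ : Matrix (Fin 3) (Fin 3) K) := by
    rw [Matrix.mul_sub, Matrix.sub_mul, Matrix.mul_smul, Matrix.smul_mul, Matrix.mul_one, hκκ]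
  simp only [hsub]
  constructor
  · intro h i j
    have h' := key (κ : Matrix (Fin 3) (Fin 3) K) ((κ⁻¹ : GL (Fin 3) K) : Matrix (Fin 3) (Fin 3) K) _ hκ hκ' h i j
    rwa [hconj, ← Matrix.mul_assoc, ← Matrix.mul_assoc, hκκ', Matrix.one_mul, Matrix.mul_assoc, hκκ', Matrix.mul_one] at h'
  · intro h i j
    rw [hconj]
    exact key _ _ _ hκ' hκ h i j

/-- Changing the residual target by an element of `𝔪`: if `|u − c| < 1` then `M ≡ c·1 ⟺ M ≡ u·1 (mod 𝔪)`. [folklore] -/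
theorem forall_v_sub_lt_one_iff_of_v_sub_lt_one {M : Matrix (Fin 3) (Fin 3) K} {c u : K} (huc : Valued.v (u - c) < 1) :
    (∀ i j, Valued.v (M i j - c * (1 : Matrix (Fin 3) (Fin 3) K) i j) < 1) ↔ ∀ i j, Valued.v (M i j - u * (1 : Matrix (Fin 3) (Fin 3) K) i j) < 1 := by
  have h1 : ∀ i j, Valued.v ((u - c) * (1 : Matrix (Fin 3) (Fin 3) K) i j) < 1 := fun i j => by
    rw [Matrix.one_apply]; split_ifs
    · rw [mul_one]; exact huc
    · rw [mul_zero, map_zero]; exact zero_lt_one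
  refine forall_congr' fun i => forall_congr' fun j => ⟨fun h => ?_, fun h => ?_⟩
  · have e : M i j - u * (1 : Matrix (Fin 3) (Fin 3) K) i j = (M i j - c * (1 : Matrix (Fin 3) (Fin 3) K) i j) - (u - c) * (1 : Matrix (Fin 3) (Fin 3) K) i j := by ring
    rw [e]; exact Valuation.map_sub_lt _ h (h1 i j)
  · have e : M i j - c * (1 : Matrix (Fin 3) (Fin 3) K) i j = (M i j - u * (1 : Matrix (Fin 3) (Fin 3) K) i j) + (u - c) * (1 : Matrix (Fin 3) (Fin 3) K) i j := by ring
    rw [e]; exact Valuation.map_add_lt _ h (h1 i j)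

/-- Scaling the residual target by a unit: `u⁻¹M ≡ 1 ⟺ M ≡ u·1 (mod 𝔪)`, in the `≤ |ϖ|` spelling of ★ ROW 0. [folklore] -/
theorem forall_v_inv_smul_sub_one_le_iff {ϖ : K} (hϖ : Valued.v ϖ = WithZero.exp (-1 : ℤ)) {M : Matrix (Fin 3) (Fin 3) K} {u : K} (hvu : Valued.v u = 1) :
    (∀ i j, Valued.v ((u⁻¹ • M - 1) i j) ≤ Valued.v ϖ) ↔ ∀ i j, Valued.v (M i j - u * (1 : Matrix (Fin 3) (Fin 3) K) i j) < 1 := by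
  have hu0 : u ≠ 0 := fun h => by rw [h, map_zero] at hvu; exact zero_ne_one hvu
  refine forall_congr' fun i => forall_congr' fun j => ?_
  rw [hϖ, ← v_lt_one_iff, Matrix.sub_apply, Matrix.smul_apply, smul_eq_mul]
  have e : u⁻¹ * M i j - (1 : Matrix (Fin 3) (Fin 3) K) i j = u⁻¹ * (M i j - u * (1 : Matrix (Fin 3) (Fin 3) K) i j) := by
    rw [mul_sub, ← mul_assoc, inv_mul_cancel₀ hu0, one_mul]
  rw [e, map_mul, map_inv₀, hvu, inv_one, one_mul]

/-! ### §2 The level-one count as ★ ROW 0's stratum count of `γ₁ = u⁻¹γ` -/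

set_option synthInstance.maxHeartbeats 400000 in
-- as above
/-- **`ℓ₁(γ) = #{q ∈ Fix_{γ₁}(U ⧸ K₀) : rank(red(q.out⁻¹γ₁q.out) − 1) = 0}`** for `γ₁ = zγ`, `z = u⁻¹·1` the inverse of the norm-one normalising scalar (`c ≡ u`):
the level-one subtype of rung 1 (section `r`, residual target `c`) is ★ ROW 0's rank-zero stratum of `γ₁`. [cite: Kottwitz1986BaseChangeUnits, §1 pp. 240–241] [cite: Rogawski1990, §4.9 Prop. 4.9.1 (b) p. 55] -/
theorem natCard_levelOne_eq_ncard_rankZero [ValuativeRel K] [(Valued.v : Valuation K ℤᵐ⁰).Compatible]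
    (hvσ : ∀ a, Valued.v (σ a) = Valued.v a) {ϖ : K} (hϖ : Valued.v ϖ = WithZero.exp (-1 : ℤ))
    (γ : ↥(unitaryGroupOfForm σ ((StdForm.antidiagonal 3).over K)))
    (r : ↥(unitaryGroupOfForm σ ((StdForm.antidiagonal 3).over K)) ⧸ (glInt 3 K).subgroupOf (unitaryGroupOfForm σ ((StdForm.antidiagonal 3).over K)) →
      ↥(unitaryGroupOfForm σ ((StdForm.antidiagonal 3).over K)))
    (hr : Function.RightInverse r QuotientGroup.mk)
    {c : K} {u : K} (hvu : Valued.v u = 1) (huc : Valued.v (u - c) < 1)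
    {z : ↥(unitaryGroupOfForm σ ((StdForm.antidiagonal 3).over K))} (hz : ((z : GL (Fin 3) K) : Matrix (Fin 3) (Fin 3) K) = u⁻¹ • (1 : Matrix (Fin 3) (Fin 3) K)) :
    Nat.card {x : fixedBy (↥(unitaryGroupOfForm σ ((StdForm.antidiagonal 3).over K)) ⧸
          (glInt 3 K).subgroupOf (unitaryGroupOfForm σ ((StdForm.antidiagonal 3).over K))) γ //
        ∀ i j, Valued.v (((((r x.1)⁻¹ * γ * r x.1 : ↥(unitaryGroupOfForm σ ((StdForm.antidiagonal 3).over K))) : GL (Fin 3) K) :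
          Matrix (Fin 3) (Fin 3) K) i j - c * (1 : Matrix (Fin 3) (Fin 3) K) i j) < 1} =
      {q : ↥(unitaryGroupOfForm σ ((StdForm.antidiagonal 3).over K)) ⧸ (glInt 3 K).subgroupOf (unitaryGroupOfForm σ ((StdForm.antidiagonal 3).over K)) |
          q ∈ fixedBy (↥(unitaryGroupOfForm σ ((StdForm.antidiagonal 3).over K)) ⧸
            (glInt 3 K).subgroupOf (unitaryGroupOfForm σ ((StdForm.antidiagonal 3).over K))) (z * γ) ∧
          (redMat ((((q.out)⁻¹ * (z * γ) * q.out : ↥(unitaryGroupOfForm σ ((StdForm.antidiagonal 3).over K))) : GL (Fin 3) K) : Matrix (Fin 3) (Fin 3) K) - 1).rank = 0}.ncard := by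
  classical
  have hu0 : u ≠ 0 := fun h => by rw [h, map_zero] at hvu; exact zero_ne_one hvu
  have hvu' : Valued.v u⁻¹ = 1 := by rw [map_inv₀, hvu, inv_one]
  have hfix := fixedBy_unitScalar_mul_eq hvσ hvu' hz γ
  -- the stratum predicate at `q ∈ Fix_γ`, read on the representative `r q`
  have hpred : ∀ q ∈ fixedBy (↥(unitaryGroupOfForm σ ((StdForm.antidiagonal 3).over K)) ⧸
      (glInt 3 K).subgroupOf (unitaryGroupOfForm σ ((StdForm.antidiagonal 3).over K))) γ,
      (redMat ((((q.out)⁻¹ * (z * γ) * q.out : ↥(unitaryGroupOfForm σ ((StdForm.antidiagonal 3).over K))) : GL (Fin 3) K) : Matrix (Fin 3) (Fin 3) K) - 1).rank = 0 ↔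
        ∀ i j, Valued.v (((((r q)⁻¹ * γ * r q : ↥(unitaryGroupOfForm σ ((StdForm.antidiagonal 3).over K))) : GL (Fin 3) K) :
          Matrix (Fin 3) (Fin 3) K) i j - c * (1 : Matrix (Fin 3) (Fin 3) K) i j) < 1 := by
    intro q hq
    have hq1 : q ∈ fixedBy _ (z * γ) := by rw [hfix]; exact hq
    have hint := coe_out_inv_mul_mul_out_mem_glInt_of_mem_fixedBy' σ _ (z * γ) hq1
    rw [rank_redMat_sub_one_eq_zero_iff_forall_valuation_le (isUniformizingElement_of_v_eq hϖ) hint]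
    -- `q.out⁻¹ (zγ) q.out = u⁻¹ • (q.out⁻¹ γ q.out)`
    have hmat : ((((q.out)⁻¹ * (z * γ) * q.out : ↥(unitaryGroupOfForm σ ((StdForm.antidiagonal 3).over K))) : GL (Fin 3) K) : Matrix (Fin 3) (Fin 3) K) =
        u⁻¹ • ((((q.out)⁻¹ * γ * q.out : ↥(unitaryGroupOfForm σ ((StdForm.antidiagonal 3).over K))) : GL (Fin 3) K) : Matrix (Fin 3) (Fin 3) K) := by
      simp only [Subgroup.coe_mul, Subgroup.coe_inv, Units.val_mul, hz, Matrix.mul_smul, Matrix.smul_mul, Matrix.one_mul]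
    simp only [← v_le_iff_valuation_le, hmat]
    rw [forall_v_inv_smul_sub_one_le_iff hϖ hvu, ← forall_v_sub_lt_one_iff_of_v_sub_lt_one huc]
    -- change of representative `q.out = r q · κ`, `κ ∈ K₀`
    have hrq : (QuotientGroup.mk (r q) : ↥(unitaryGroupOfForm σ ((StdForm.antidiagonal 3).over K)) ⧸
        (glInt 3 K).subgroupOf (unitaryGroupOfForm σ ((StdForm.antidiagonal 3).over K))) = QuotientGroup.mk q.out := by
      rw [QuotientGroup.out_eq']; exact hr q
    rw [QuotientGroup.eq, Subgroup.mem_subgroupOf] at hrq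
    obtain ⟨hκ, hκ'⟩ := (Literature.NumberTheory.Automorphic.mem_glInt_iff_forall_v_le_one _).1 hrq
    have e : (((q.out)⁻¹ * γ * q.out : ↥(unitaryGroupOfForm σ ((StdForm.antidiagonal 3).over K))) : GL (Fin 3) K) =
        ((r q)⁻¹ * q.out : ↥(unitaryGroupOfForm σ ((StdForm.antidiagonal 3).over K)))⁻¹ * ((r q)⁻¹ * γ * r q : ↥(unitaryGroupOfForm σ ((StdForm.antidiagonal 3).over K))) *
          ((r q)⁻¹ * q.out : ↥(unitaryGroupOfForm σ ((StdForm.antidiagonal 3).over K))) := by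
      simp only [Subgroup.coe_mul, Subgroup.coe_inv]; group
    rw [e, Units.val_mul, Units.val_mul]
    exact forall_v_conj_sub_lt_one_iff hκ hκ' c
  -- count: subtype of a subtype ↔ set with a conjunction
  rw [← Nat.card_coe_set_eq]
  refine Nat.card_congr ((Equiv.subtypeSubtypeEquivSubtypeInter
    (fun q => q ∈ fixedBy (↥(unitaryGroupOfForm σ ((StdForm.antidiagonal 3).over K)) ⧸
      (glInt 3 K).subgroupOf (unitaryGroupOfForm σ ((StdForm.antidiagonal 3).over K))) γ)
    (fun q => ∀ i j, Valued.v (((((r q)⁻¹ * γ * r q : ↥(unitaryGroupOfForm σ ((StdForm.antidiagonal 3).over K))) : GL (Fin 3) K) :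
      Matrix (Fin 3) (Fin 3) K) i j - c * (1 : Matrix (Fin 3) (Fin 3) K) i j) < 1)).trans (Equiv.subtypeEquivRight fun q => ?_))
  show (q ∈ fixedBy _ γ ∧ _) ↔ q ∈ fixedBy _ (z * γ) ∧ _
  constructor
  · rintro ⟨hq, hP⟩
    exact ⟨by rw [hfix]; exact hq, (hpred q hq).2 hP⟩
  · rintro ⟨hq, hR⟩
    have hq' : q ∈ fixedBy _ γ := by rw [← hfix]; exact hq
    exact ⟨hq', (hpred q hq').1 hR⟩

/-! ### §3 ★ ROW 0 = #Fix(Y): `ℓ₁(γ) = #Fix_Y(U ⧸ K₀)` (head (R2.b)) -/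

/-- `|u| = 1` for a unit congruent to the unit `c`. [folklore] -/
theorem v_eq_one_of_v_sub_lt_one {c u : K} (hc : Valued.v c = 1) (huc : Valued.v (u - c) < 1) : Valued.v u = 1 := by
  have h : Valued.v (c + (u - c)) = Valued.v c := Valuation.map_add_eq_of_lt_left _ (by rw [hc]; exact huc)
  rwa [add_sub_cancel, hc] at h

set_option synthInstance.maxHeartbeats 400000 in
-- as above
/-- **G1 RUNG 2 (R2.b) — THE LEVEL-ONE COUNT IS THE FIXED-POINT COUNT OF A CAYLEY UNIT: `ℓ₁(γ) = #Fix_Y(U ⧸ K₀)`.**  For `γ ∈ U(σ, J₀)(K)`, a unit `c` and a norm-one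
`u ≡ c (mod 𝔪)` (`σu·u = 1`), and a unit `Y ∈ U` of the shifted order of `γ₁ = u⁻¹γ` — `Y, Y⁻¹ ∈ 𝒪[X]`, `X ∈ 𝒪[Y]`, `X = 1 + ϖ⁻¹(u⁻¹γ − 1)` (★ ROW 0's three memberships,
`𝒪` the `ValuativeRel` integers) — the level-one count of rung 1 (section `r` of `U → U ⧸ K₀`, residual target `c`) equals `#Fix_Y(U ⧸ K₀)`:
§2 ∘ ★ `ncard_fixedBy_unitary_rank_zero_eq_natCard_fixedBy_of_mem_adjoin`. [cite: Kottwitz1986BaseChangeUnits, §1 pp. 240–241] [cite: Rogawski1990, §4.9 Prop. 4.9.1 (b) p. 55] [cite: Serre1980Trees, Ch. II §1.1–1.2] -/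
theorem natCard_levelOne_eq_natCard_fixedBy_of_mem_adjoin [ValuativeRel K] [(Valued.v : Valuation K ℤᵐ⁰).Compatible]
    (hvσ : ∀ a, Valued.v (σ a) = Valued.v a) {ϖ : K} (hϖ : Valued.v ϖ = WithZero.exp (-1 : ℤ))
    (γ : ↥(unitaryGroupOfForm σ ((StdForm.antidiagonal 3).over K)))
    (r : ↥(unitaryGroupOfForm σ ((StdForm.antidiagonal 3).over K)) ⧸ (glInt 3 K).subgroupOf (unitaryGroupOfForm σ ((StdForm.antidiagonal 3).over K)) →
      ↥(unitaryGroupOfForm σ ((StdForm.antidiagonal 3).over K)))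
    (hr : Function.RightInverse r QuotientGroup.mk)
    {c : K} (hc : Valued.v c = 1) {u : K} (hσu : σ u * u = 1) (huc : Valued.v (u - c) < 1)
    (Y : ↥(unitaryGroupOfForm σ ((StdForm.antidiagonal 3).over K)))
    (hY : ((Y : GL (Fin 3) K) : Matrix (Fin 3) (Fin 3) K) ∈ Algebra.adjoin 𝒪[K]
      ({1 + ϖ⁻¹ • (u⁻¹ • ((γ : GL (Fin 3) K) : Matrix (Fin 3) (Fin 3) K) - 1)} : Set (Matrix (Fin 3) (Fin 3) K)))
    (hY' : ((((Y : GL (Fin 3) K))⁻¹ : GL (Fin 3) K) : Matrix (Fin 3) (Fin 3) K) ∈ Algebra.adjoin 𝒪[K]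
      ({1 + ϖ⁻¹ • (u⁻¹ • ((γ : GL (Fin 3) K) : Matrix (Fin 3) (Fin 3) K) - 1)} : Set (Matrix (Fin 3) (Fin 3) K)))
    (hX : (1 + ϖ⁻¹ • (u⁻¹ • ((γ : GL (Fin 3) K) : Matrix (Fin 3) (Fin 3) K) - 1)) ∈ Algebra.adjoin 𝒪[K]
      ({((Y : GL (Fin 3) K) : Matrix (Fin 3) (Fin 3) K)} : Set (Matrix (Fin 3) (Fin 3) K))) :
    Nat.card {x : fixedBy (↥(unitaryGroupOfForm σ ((StdForm.antidiagonal 3).over K)) ⧸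
          (glInt 3 K).subgroupOf (unitaryGroupOfForm σ ((StdForm.antidiagonal 3).over K))) γ //
        ∀ i j, Valued.v (((((r x.1)⁻¹ * γ * r x.1 : ↥(unitaryGroupOfForm σ ((StdForm.antidiagonal 3).over K))) : GL (Fin 3) K) :
          Matrix (Fin 3) (Fin 3) K) i j - c * (1 : Matrix (Fin 3) (Fin 3) K) i j) < 1} =
      Nat.card (fixedBy (↥(unitaryGroupOfForm σ ((StdForm.antidiagonal 3).over K)) ⧸
          (glInt 3 K).subgroupOf (unitaryGroupOfForm σ ((StdForm.antidiagonal 3).over K))) Y) := by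
  have hvu : Valued.v u = 1 := v_eq_one_of_v_sub_lt_one hc huc
  have hu0 : u ≠ 0 := fun h => by rw [h, map_zero] at hvu; exact zero_ne_one hvu
  have hσu' : σ u⁻¹ * u⁻¹ = 1 := by rw [map_inv₀, ← mul_inv, hσu, inv_one]
  obtain ⟨z, hz, -⟩ := exists_unitScalar_mem_unitaryGroupOfForm (σ := σ) hσu'
  rw [natCard_levelOne_eq_ncard_rankZero hvσ hϖ γ r hr hvu huc hz]
  -- `(zγ : U)` has matrix `u⁻¹ • γ`
  have hzγ : (((z * γ : ↥(unitaryGroupOfForm σ ((StdForm.antidiagonal 3).over K))) : GL (Fin 3) K) : Matrix (Fin 3) (Fin 3) K) =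
      u⁻¹ • ((γ : GL (Fin 3) K) : Matrix (Fin 3) (Fin 3) K) := by
    rw [Subgroup.coe_mul, Units.val_mul, hz, Matrix.smul_mul, Matrix.one_mul]
  rw [← hzγ] at hY hY' hX
  -- ★ ROW 0 = #Fix(Y), on the `GL`-presented form `J₀`
  exact ncard_fixedBy_unitary_rank_zero_eq_natCard_fixedBy_of_mem_adjoin σ
    (⟨(StdForm.antidiagonal 3).over K, (StdForm.antidiagonal 3).over K, StdForm.over_mul_over _ K, StdForm.over_mul_over _ K⟩ : GL (Fin 3) K)
    (isUniformizingElement_of_v_eq hϖ) (z * γ) Y hY hY' hX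

/-! ### §4 `Fix_Y ⊆ Fix_γ`: the fixed cosets of the Cayley unit are finite when those of `γ` are -/

set_option synthInstance.maxHeartbeats 400000 in
-- as above
/-- **`Fix_Y(U ⧸ K₀) ⊆ Fix_γ(U ⧸ K₀)`** for `Y ∈ U` with `X = 1 + ϖ⁻¹(u⁻¹γ − 1) ∈ 𝒪[Y]` (`|u| = 1`): a coset `gK₀` with `g⁻¹Yg` integral has `g⁻¹Xg` integral (the matrices `B` with
`g⁻¹Bg` integral form an `𝒪`-subalgebra containing `Y`), hence `g⁻¹γg = u·(1 + ϖ(g⁻¹Xg − 1))` integral, i.e. `gK₀ ∈ Fix_γ` (a unitary integral matrix lies in `GL₃(𝒪)`).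
[cite: Kottwitz1986BaseChangeUnits, §1 pp. 240–241] [cite: Serre1980Trees, Ch. II §1.1–1.2] -/
theorem fixedBy_subset_fixedBy_of_mem_adjoin [ValuativeRel K] [(Valued.v : Valuation K ℤᵐ⁰).Compatible]
    (hvσ : ∀ a, Valued.v (σ a) = Valued.v a) {ϖ : K} (hϖ : Valued.v ϖ = WithZero.exp (-1 : ℤ))
    (γ : ↥(unitaryGroupOfForm σ ((StdForm.antidiagonal 3).over K))) {u : K} (hvu : Valued.v u = 1)
    (Y : ↥(unitaryGroupOfForm σ ((StdForm.antidiagonal 3).over K)))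
    (hX : (1 + ϖ⁻¹ • (u⁻¹ • ((γ : GL (Fin 3) K) : Matrix (Fin 3) (Fin 3) K) - 1)) ∈ Algebra.adjoin 𝒪[K]
      ({((Y : GL (Fin 3) K) : Matrix (Fin 3) (Fin 3) K)} : Set (Matrix (Fin 3) (Fin 3) K))) :
    fixedBy (↥(unitaryGroupOfForm σ ((StdForm.antidiagonal 3).over K)) ⧸
        (glInt 3 K).subgroupOf (unitaryGroupOfForm σ ((StdForm.antidiagonal 3).over K))) Y ⊆
      fixedBy (↥(unitaryGroupOfForm σ ((StdForm.antidiagonal 3).over K)) ⧸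
        (glInt 3 K).subgroupOf (unitaryGroupOfForm σ ((StdForm.antidiagonal 3).over K))) γ := by
  have hϖ1 : Valued.v ϖ ≤ 1 := by rw [hϖ, ← WithZero.exp_zero, WithZero.exp_le_exp]; norm_num
  have hϖ0 : ϖ ≠ 0 := fun h0 => by rw [h0, map_zero] at hϖ; exact WithZero.zero_ne_coe hϖ
  have hu0 : u ≠ 0 := fun h => by rw [h, map_zero] at hvu; exact zero_ne_one hvu
  intro q hq
  -- the representative `g = q.out`, `g⁻¹ Y g ∈ GL₃(𝒪)`
  set g : ↥(unitaryGroupOfForm σ ((StdForm.antidiagonal 3).over K)) := q.out with hg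
  have hqg : (QuotientGroup.mk g : ↥(unitaryGroupOfForm σ ((StdForm.antidiagonal 3).over K)) ⧸
      (glInt 3 K).subgroupOf (unitaryGroupOfForm σ ((StdForm.antidiagonal 3).over K))) = q := QuotientGroup.out_eq' q
  have hYg : ((g⁻¹ * Y * g : ↥(unitaryGroupOfForm σ ((StdForm.antidiagonal 3).over K))) : GL (Fin 3) K) ∈ glInt 3 K := by
    have h := (mem_fixedBy_quotient_mk_iff ((glInt 3 K).subgroupOf (unitaryGroupOfForm σ ((StdForm.antidiagonal 3).over K))) Y g).1 (by rw [hqg]; exact hq)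
    exact Subgroup.mem_subgroupOf.1 h
  rw [← hqg, mem_fixedBy_quotient_mk_iff, Subgroup.mem_subgroupOf, UnitaryGroup.mem_glInt_iff_forall_v_le_one σ rfl hvσ]
  -- the `𝒪`-subalgebra of matrices `B` with `g⁻¹ B g` integral
  set gM : Matrix (Fin 3) (Fin 3) K := ((g : GL (Fin 3) K) : Matrix (Fin 3) (Fin 3) K) with hgM
  set gM' : Matrix (Fin 3) (Fin 3) K := (((g : GL (Fin 3) K)⁻¹ : GL (Fin 3) K) : Matrix (Fin 3) (Fin 3) K) with hgM'
  have hgg : gM * gM' = 1 := by rw [hgM, hgM', ← Units.val_mul, mul_inv_cancel, Units.val_one]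
  have hmul : ∀ A B : Matrix (Fin 3) (Fin 3) K, (∀ i j, Valued.v (A i j) ≤ 1) → (∀ i j, Valued.v (B i j) ≤ 1) → ∀ i j, Valued.v ((A * B) i j) ≤ 1 := by
    intro A B hA hB i j
    rw [Matrix.mul_apply]
    refine Valuation.map_sum_le _ fun l _ => ?_
    rw [map_mul]; exact mul_le_one' (hA i l) (hB l j)
  let S : Subalgebra 𝒪[K] (Matrix (Fin 3) (Fin 3) K) :=
    { carrier := {B | ∀ i j, Valued.v ((gM' * B * gM) i j) ≤ 1}
      mul_mem' := by
        intro A B hA hB i j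
        have e : gM' * (A * B) * gM = (gM' * A * gM) * (gM' * B * gM) := by
          calc gM' * (A * B) * gM = gM' * A * (gM * gM') * B * gM := by rw [hgg, Matrix.mul_one]; simp only [Matrix.mul_assoc]
            _ = (gM' * A * gM) * (gM' * B * gM) := by simp only [Matrix.mul_assoc]
        show Valued.v ((gM' * (A * B) * gM) i j) ≤ 1
        rw [e]
        exact hmul _ _ hA hB i j
      one_mem' := by
        intro i j
        rw [Matrix.mul_one, hgM', hgM, ← Units.val_mul, inv_mul_cancel, Units.val_one, Matrix.one_apply]
        split_ifs
        · rw [map_one]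
        · rw [map_zero]; exact zero_le_one
      add_mem' := by
        intro A B hA hB i j
        rw [Matrix.mul_add, Matrix.add_mul, Matrix.add_apply]
        exact Valuation.map_add_le _ (hA i j) (hB i j)
      zero_mem' := by intro i j; rw [Matrix.mul_zero, Matrix.zero_mul, Matrix.zero_apply, map_zero]; exact zero_le_one
      algebraMap_mem' := by
        intro a i j
        rw [Algebra.algebraMap_eq_smul_one, Matrix.mul_smul, Matrix.smul_mul, Matrix.mul_one, hgM', hgM, ← Units.val_mul, inv_mul_cancel, Units.val_one,
          Matrix.smul_apply, Matrix.one_apply]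
        split_ifs
        · rw [Subring.smul_def, smul_eq_mul, mul_one]; exact (v_le_one_iff_mem_integer _).2 a.2
        · rw [smul_zero, map_zero]; exact zero_le_one }
  have hYS : ((Y : GL (Fin 3) K) : Matrix (Fin 3) (Fin 3) K) ∈ S := by
    show ∀ i j, Valued.v ((gM' * ((Y : GL (Fin 3) K) : Matrix (Fin 3) (Fin 3) K) * gM) i j) ≤ 1
    have e : gM' * ((Y : GL (Fin 3) K) : Matrix (Fin 3) (Fin 3) K) * gM = (((g⁻¹ * Y * g : ↥(unitaryGroupOfForm σ ((StdForm.antidiagonal 3).over K))) : GL (Fin 3) K) : Matrix (Fin 3) (Fin 3) K) := by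
      rw [hgM', hgM, Subgroup.coe_mul, Subgroup.coe_mul, Subgroup.coe_inv, Units.val_mul, Units.val_mul]
    rw [e]
    exact ((Literature.NumberTheory.Automorphic.mem_glInt_iff_forall_v_le_one _).1 hYg).1
  have hXS : (1 + ϖ⁻¹ • (u⁻¹ • ((γ : GL (Fin 3) K) : Matrix (Fin 3) (Fin 3) K) - 1)) ∈ S :=
    (Algebra.adjoin_le (Set.singleton_subset_iff.2 hYS) : Algebra.adjoin 𝒪[K] _ ≤ S) hX
  -- `g⁻¹ γ g = u • (gM' X gM) * ϖ-bookkeeping`: `γ = u • (1 + ϖ • (X − 1))`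
  set X : Matrix (Fin 3) (Fin 3) K := 1 + ϖ⁻¹ • (u⁻¹ • ((γ : GL (Fin 3) K) : Matrix (Fin 3) (Fin 3) K) - 1) with hXdef
  have hγX : ((γ : GL (Fin 3) K) : Matrix (Fin 3) (Fin 3) K) = u • (1 + ϖ • (X - 1)) := by
    rw [hXdef, add_sub_cancel_left, smul_smul, mul_inv_cancel₀ hϖ0, one_smul, add_sub_cancel, smul_smul, mul_inv_cancel₀ hu0, one_smul]
  have hconj : (((g⁻¹ * γ * g : ↥(unitaryGroupOfForm σ ((StdForm.antidiagonal 3).over K))) : GL (Fin 3) K) : Matrix (Fin 3) (Fin 3) K) =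
      u • (1 + ϖ • (gM' * X * gM - 1)) := by
    rw [Subgroup.coe_mul, Subgroup.coe_mul, Subgroup.coe_inv, Units.val_mul, Units.val_mul, Matrix.coe_units_inv, hγX, ← hgM, ← Matrix.coe_units_inv, ← hgM']
    rw [Matrix.mul_smul, Matrix.smul_mul, Matrix.mul_add, Matrix.add_mul, Matrix.mul_one, Matrix.mul_smul, Matrix.smul_mul, Matrix.mul_sub, Matrix.sub_mul,
      Matrix.mul_one, hgM', hgM, ← Units.val_mul, inv_mul_cancel, Units.val_one]
  intro i j
  rw [hconj, Matrix.smul_apply, smul_eq_mul, map_mul, hvu, one_mul, Matrix.add_apply, Matrix.smul_apply, smul_eq_mul]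
  refine Valuation.map_add_le _ ?_ ?_
  · rw [Matrix.one_apply]; split_ifs
    · rw [map_one]
    · rw [map_zero]; exact zero_le_one
  · rw [map_mul, Matrix.sub_apply]
    refine mul_le_one' hϖ1 (Valuation.map_sub_le _ (hXS i j) ?_)
    rw [Matrix.one_apply]; split_ifs
    · rw [map_one]
    · rw [map_zero]; exact zero_le_one

set_option synthInstance.maxHeartbeats 400000 in
-- as above
/-- **`Fix_Y(U ⧸ K₀)` is finite when `Fix_γ(U ⧸ K₀)` is** — the finiteness binder ★ a₀ needs at the Cayley unit `Y`. [cite: Kottwitz1986BaseChangeUnits, §1 pp. 240–241] -/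
theorem finite_fixedBy_of_mem_adjoin [ValuativeRel K] [(Valued.v : Valuation K ℤᵐ⁰).Compatible]
    (hvσ : ∀ a, Valued.v (σ a) = Valued.v a) {ϖ : K} (hϖ : Valued.v ϖ = WithZero.exp (-1 : ℤ))
    (γ : ↥(unitaryGroupOfForm σ ((StdForm.antidiagonal 3).over K))) {u : K} (hvu : Valued.v u = 1)
    (Y : ↥(unitaryGroupOfForm σ ((StdForm.antidiagonal 3).over K)))
    (hX : (1 + ϖ⁻¹ • (u⁻¹ • ((γ : GL (Fin 3) K) : Matrix (Fin 3) (Fin 3) K) - 1)) ∈ Algebra.adjoin 𝒪[K]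
      ({((Y : GL (Fin 3) K) : Matrix (Fin 3) (Fin 3) K)} : Set (Matrix (Fin 3) (Fin 3) K)))
    (hfin : (fixedBy (↥(unitaryGroupOfForm σ ((StdForm.antidiagonal 3).over K)) ⧸
        (glInt 3 K).subgroupOf (unitaryGroupOfForm σ ((StdForm.antidiagonal 3).over K))) γ).Finite) :
    (fixedBy (↥(unitaryGroupOfForm σ ((StdForm.antidiagonal 3).over K)) ⧸
        (glInt 3 K).subgroupOf (unitaryGroupOfForm σ ((StdForm.antidiagonal 3).over K))) Y).Finite :=
  hfin.subset (fixedBy_subset_fixedBy_of_mem_adjoin hvσ hϖ γ hvu Y hX)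

end Summit.HodgeConjecture.HodgeConjecture.R90.S6

end
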